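import Mathlib
import Summits.Ventures.HodgeRepro2.T5AdicCompletionRamified
import Summits.Ventures.HodgeRepro2.T5RamifiedNormTransfer
import Summits.Ventures.HodgeRepro2.T5AdicCompletionGaloisInvariance
import Summits.Ventures.HodgeRepro2.T5QuadraticAutomorphism

/-!
# The ramified quadratic place: the basis `(1, π)`, its integrality, and the `σ`-difference estimate
(T5RamifiedIntegralBasis)

Setting (rows 87 / 165 of route/LEAN-ANNEX-p4.md): `K ⊆ L` number fields, `w ∣ v`, `K_v ⊆ L_w` Mathlib's completions,
`[L_w : K_v] = 2`, `ϖ` a uniformiser of `O_{K_v}` NOT irreducible in `O_{L_w}` (the place is ramified), `π` a uniformiser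
of `O_{L_w}`, `σ ≠ 1` in `Gal(L_w/K_v)`.

* PARITY: `v(alg a) = v(a)²` (row 165) is `exp(2k)` while `v(alg b · π) = exp(2l − 1)`: the two summands of
  `alg a + alg b · π` never have the same value, so `v(alg a + alg b π) = max` of the two.
* THE BASIS: `π ∉ K_v`, `(1, π)` is a `K_v`-basis of `L_w`; every `y ∈ L_w` is `alg a + alg b · π`, and `y` integral
  forces `a, b` integral (`O_{L_w} = O_{K_v} ⊕ O_{K_v} π`).
* THE `σ`-DIFFERENCE: `σ y − y = alg b · (σ π − π)`; `σ π ≠ π`, so `v(σ π − π) = exp(−i)` with `i ≥ 1` (the exponent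
  `i = v_E(σπ − π)` — Serre's `i_G(σ)`, the break `t = i − 1`); and `v(y) ≤ exp(−m)` gives
  `v(σ y − y) ≤ exp(1 − m) · v(σ π − π)`, i.e. `v_E(σ y − y) ≥ m + t` (`σ ∈ G_t`); for integral `y`,
  `v(σ y − y) ≤ v(σ π − π)`.
* The trace `π + σ π` and the norm `π · σ π` of the uniformiser lie in `K_v` (fixed by `σ`, row 113).
This is the elementary input for the exact conductor of `η_v` at a ramified place (T5RamifiedBreak and its sequels).
-/

namespace Summit.Ventures.HodgeRepro2.T5RamifiedIntegralBasis

open IsDedekindDomain HeightOneSpectrum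

variable {K : Type*} [Field K] [NumberField K] (v : HeightOneSpectrum (NumberField.RingOfIntegers K))
  {L : Type*} [Field L] [NumberField L] [Algebra K L] (w : HeightOneSpectrum (NumberField.RingOfIntegers L))
  [w.asIdeal.LiesOver v.asIdeal]

noncomputable section

/-! ### Facts needing only `[L_w : K_v] = 2` and `σ ≠ 1` -/

/-- `σ(alg a + alg b π) − (alg a + alg b π) = alg b · (σ π − π)`. -/
theorem algEquiv_sub_self (σ : (w.adicCompletion L) ≃ₐ[v.adicCompletion K] (w.adicCompletion L))
    (π : w.adicCompletionIntegers L) (a b : v.adicCompletion K) :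
    σ (algebraMap (v.adicCompletion K) (w.adicCompletion L) a +
        algebraMap (v.adicCompletion K) (w.adicCompletion L) b * (π : w.adicCompletion L)) -
      (algebraMap (v.adicCompletion K) (w.adicCompletion L) a +
        algebraMap (v.adicCompletion K) (w.adicCompletion L) b * (π : w.adicCompletion L)) =
      algebraMap (v.adicCompletion K) (w.adicCompletion L) b * (σ (π : w.adicCompletion L) - π) := by
  simp only [map_add, map_mul, AlgEquiv.commutes]
  ring

/-- A `σ`-fixed element comes from `K_v` (row 113). -/
theorem exists_algebraMap_eq_of_fixed (h2 : Module.finrank (v.adicCompletion K) (w.adicCompletion L) = 2)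
    (σ : (w.adicCompletion L) ≃ₐ[v.adicCompletion K] (w.adicCompletion L)) (hσ : σ ≠ 1)
    {z : w.adicCompletion L} (hz : σ z = z) :
    ∃ c : v.adicCompletion K, algebraMap (v.adicCompletion K) (w.adicCompletion L) c = z := by
  haveI : FiniteDimensional (v.adicCompletion K) (w.adicCompletion L) := Module.finite_of_finrank_pos (by omega)
  exact T5QuadraticAutomorphism.mem_range_of_fixed h2 σ hσ hz

/-- `σ ∘ σ = id` (row 113). -/
theorem algEquiv_algEquiv (h2 : Module.finrank (v.adicCompletion K) (w.adicCompletion L) = 2)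
    (σ : (w.adicCompletion L) ≃ₐ[v.adicCompletion K] (w.adicCompletion L)) (hσ : σ ≠ 1)
    (z : w.adicCompletion L) : σ (σ z) = z := by
  haveI : FiniteDimensional (v.adicCompletion K) (w.adicCompletion L) := Module.finite_of_finrank_pos (by omega)
  exact T5QuadraticAutomorphism.apply_apply h2 σ hσ z

/-- The trace `z + σ z` comes from `K_v`. -/
theorem exists_algebraMap_eq_add_algEquiv (h2 : Module.finrank (v.adicCompletion K) (w.adicCompletion L) = 2)
    (σ : (w.adicCompletion L) ≃ₐ[v.adicCompletion K] (w.adicCompletion L)) (hσ : σ ≠ 1)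
    (z : w.adicCompletion L) :
    ∃ τ : v.adicCompletion K, algebraMap (v.adicCompletion K) (w.adicCompletion L) τ = z + σ z :=
  exists_algebraMap_eq_of_fixed v w h2 σ hσ (by rw [map_add, algEquiv_algEquiv v w h2 σ hσ, add_comm])

/-- The norm `z · σ z` comes from `K_v`. -/
theorem exists_algebraMap_eq_mul_algEquiv (h2 : Module.finrank (v.adicCompletion K) (w.adicCompletion L) = 2)
    (σ : (w.adicCompletion L) ≃ₐ[v.adicCompletion K] (w.adicCompletion L)) (hσ : σ ≠ 1)
    (z : w.adicCompletion L) :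
    ∃ ν : v.adicCompletion K, algebraMap (v.adicCompletion K) (w.adicCompletion L) ν = z * σ z :=
  exists_algebraMap_eq_of_fixed v w h2 σ hσ (by rw [map_mul, algEquiv_algEquiv v w h2 σ hσ, mul_comm])

/-! ### The ramified place: parity, the basis `(1, π)`, integrality, the `σ`-difference -/

section Ramified

variable [ContinuousSMul (v.adicCompletion K) (w.adicCompletion L)]

/-- `v(alg a) = exp(2 · log v(a))` for `a ≠ 0` (row 165: `v(alg a) = v(a)²`). -/
theorem val_algebraMap_eq_exp_two_mul_log (h2 : Module.finrank (v.adicCompletion K) (w.adicCompletion L) = 2)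
    {ϖ : v.adicCompletionIntegers K} (hϖ : Irreducible ϖ) {π : w.adicCompletionIntegers L} (hπ : Irreducible π)
    (hram : ¬ Irreducible (algebraMap (v.adicCompletionIntegers K) (w.adicCompletionIntegers L) ϖ))
    {a : v.adicCompletion K} (ha : a ≠ 0) :
    Valued.v (algebraMap (v.adicCompletion K) (w.adicCompletion L) a) =
      WithZero.exp (2 * WithZero.log (Valued.v a)) := by
  have h0 : Valued.v a ≠ 0 := (Valuation.ne_zero_iff _).mpr ha
  rw [T5RamifiedNormTransfer.val_algebraMap_eq_sq v w h2 hϖ hπ hram]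
  conv_lhs => rw [← WithZero.exp_log h0]
  rw [← WithZero.exp_nsmul]
  congr 1

/-- PARITY: `v(alg a) ≠ v(alg b · π)` for `a, b ≠ 0`. -/
theorem val_algebraMap_ne_val_algebraMap_mul_uniformizer
    (h2 : Module.finrank (v.adicCompletion K) (w.adicCompletion L) = 2)
    {ϖ : v.adicCompletionIntegers K} (hϖ : Irreducible ϖ) {π : w.adicCompletionIntegers L} (hπ : Irreducible π)
    (hram : ¬ Irreducible (algebraMap (v.adicCompletionIntegers K) (w.adicCompletionIntegers L) ϖ))
    {a b : v.adicCompletion K} (ha : a ≠ 0) (hb : b ≠ 0) :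
    Valued.v (algebraMap (v.adicCompletion K) (w.adicCompletion L) a) ≠
      Valued.v (algebraMap (v.adicCompletion K) (w.adicCompletion L) b * (π : w.adicCompletion L)) := by
  rw [val_algebraMap_eq_exp_two_mul_log v w h2 hϖ hπ hram ha, map_mul,
    val_algebraMap_eq_exp_two_mul_log v w h2 hϖ hπ hram hb, T5AdicCompletionNormGroup.val_uniformizer w hπ,
    ← WithZero.exp_add]
  intro h
  have := WithZero.exp_injective h
  omega

/-- `v(alg a + alg b · π) = max (v(alg a)) (v(alg b · π))`. -/
theorem val_algebraMap_add_algebraMap_mul_uniformizer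
    (h2 : Module.finrank (v.adicCompletion K) (w.adicCompletion L) = 2)
    {ϖ : v.adicCompletionIntegers K} (hϖ : Irreducible ϖ) {π : w.adicCompletionIntegers L} (hπ : Irreducible π)
    (hram : ¬ Irreducible (algebraMap (v.adicCompletionIntegers K) (w.adicCompletionIntegers L) ϖ))
    (a b : v.adicCompletion K) :
    Valued.v (algebraMap (v.adicCompletion K) (w.adicCompletion L) a +
        algebraMap (v.adicCompletion K) (w.adicCompletion L) b * (π : w.adicCompletion L)) =
      max (Valued.v (algebraMap (v.adicCompletion K) (w.adicCompletion L) a))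
        (Valued.v (algebraMap (v.adicCompletion K) (w.adicCompletion L) b * (π : w.adicCompletion L))) := by
  by_cases ha : a = 0
  · subst ha
    simp
  by_cases hb : b = 0
  · subst hb
    simp
  exact Valuation.map_add_of_distinct_val _
    (val_algebraMap_ne_val_algebraMap_mul_uniformizer v w h2 hϖ hπ hram ha hb)

/-- `π ∉ K_v`: its value `exp(−1)` is not a square. -/
theorem uniformizer_notMem_range (h2 : Module.finrank (v.adicCompletion K) (w.adicCompletion L) = 2)
    {ϖ : v.adicCompletionIntegers K} (hϖ : Irreducible ϖ) {π : w.adicCompletionIntegers L} (hπ : Irreducible π)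
    (hram : ¬ Irreducible (algebraMap (v.adicCompletionIntegers K) (w.adicCompletionIntegers L) ϖ)) :
    (π : w.adicCompletion L) ∉ Set.range (algebraMap (v.adicCompletion K) (w.adicCompletion L)) := by
  rintro ⟨c, hc⟩
  have hc0 : c ≠ 0 := by
    rintro rfl
    rw [map_zero] at hc
    exact hπ.ne_zero (by exact_mod_cast hc.symm)
  have hk := val_algebraMap_eq_exp_two_mul_log v w h2 hϖ hπ hram hc0
  rw [hc, T5AdicCompletionNormGroup.val_uniformizer w hπ] at hk
  have := WithZero.exp_injective hk
  omega

/-- `(1, π)` is linearly independent over `K_v`. -/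
theorem linearIndependent_one_uniformizer (h2 : Module.finrank (v.adicCompletion K) (w.adicCompletion L) = 2)
    {ϖ : v.adicCompletionIntegers K} (hϖ : Irreducible ϖ) {π : w.adicCompletionIntegers L} (hπ : Irreducible π)
    (hram : ¬ Irreducible (algebraMap (v.adicCompletionIntegers K) (w.adicCompletionIntegers L) ϖ)) :
    LinearIndependent (v.adicCompletion K) ![(1 : w.adicCompletion L), (π : w.adicCompletion L)] := by
  rw [LinearIndependent.pair_iff]
  intro s t hst
  rw [Algebra.smul_def, Algebra.smul_def, mul_one] at hst
  by_cases ht : t = 0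
  · subst ht
    rw [map_zero, zero_mul, add_zero] at hst
    exact ⟨(map_eq_zero _).mp hst, rfl⟩
  · exfalso
    apply uniformizer_notMem_range v w h2 hϖ hπ hram
    refine ⟨-s / t, ?_⟩
    have ht' : algebraMap (v.adicCompletion K) (w.adicCompletion L) t ≠ 0 := (map_ne_zero _).mpr ht
    rw [map_div₀, map_neg, div_eq_iff ht']
    linear_combination -hst

/-- THE BASIS: every `y ∈ L_w` is `alg a + alg b · π` with `a, b ∈ K_v`. -/
theorem exists_eq_algebraMap_add_algebraMap_mul_uniformizer
    (h2 : Module.finrank (v.adicCompletion K) (w.adicCompletion L) = 2)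
    {ϖ : v.adicCompletionIntegers K} (hϖ : Irreducible ϖ) {π : w.adicCompletionIntegers L} (hπ : Irreducible π)
    (hram : ¬ Irreducible (algebraMap (v.adicCompletionIntegers K) (w.adicCompletionIntegers L) ϖ))
    (y : w.adicCompletion L) :
    ∃ a b : v.adicCompletion K, y = algebraMap (v.adicCompletion K) (w.adicCompletion L) a +
      algebraMap (v.adicCompletion K) (w.adicCompletion L) b * (π : w.adicCompletion L) := by
  have hcard : Fintype.card (Fin 2) = Module.finrank (v.adicCompletion K) (w.adicCompletion L) := by
    simp [h2]
  set B := basisOfLinearIndependentOfCardEqFinrank (linearIndependent_one_uniformizer v w h2 hϖ hπ hram) hcard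
    with hB
  have hB0 : B 0 = 1 := by
    rw [hB, coe_basisOfLinearIndependentOfCardEqFinrank]
    rfl
  have hB1 : B 1 = (π : w.adicCompletion L) := by
    rw [hB, coe_basisOfLinearIndependentOfCardEqFinrank]
    rfl
  refine ⟨B.repr y 0, B.repr y 1, ?_⟩
  have hsum := B.sum_repr y
  rw [Fin.sum_univ_two, hB0, hB1] at hsum
  calc y = B.repr y 0 • (1 : w.adicCompletion L) + B.repr y 1 • (π : w.adicCompletion L) := hsum.symm
    _ = _ := by rw [Algebra.smul_def, Algebra.smul_def, mul_one]

/-- INTEGRALITY: `y` integral ⇒ `a, b` integral (`O_{L_w} = O_{K_v} ⊕ O_{K_v} π`). -/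
theorem exists_eq_algebraMap_add_algebraMap_mul_uniformizer_of_val_le_one
    (h2 : Module.finrank (v.adicCompletion K) (w.adicCompletion L) = 2)
    {ϖ : v.adicCompletionIntegers K} (hϖ : Irreducible ϖ) {π : w.adicCompletionIntegers L} (hπ : Irreducible π)
    (hram : ¬ Irreducible (algebraMap (v.adicCompletionIntegers K) (w.adicCompletionIntegers L) ϖ))
    {y : w.adicCompletion L} (hy : Valued.v y ≤ 1) :
    ∃ a b : v.adicCompletion K, Valued.v a ≤ 1 ∧ Valued.v b ≤ 1 ∧
      y = algebraMap (v.adicCompletion K) (w.adicCompletion L) a +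
        algebraMap (v.adicCompletion K) (w.adicCompletion L) b * (π : w.adicCompletion L) := by
  obtain ⟨a, b, rfl⟩ := exists_eq_algebraMap_add_algebraMap_mul_uniformizer v w h2 hϖ hπ hram y
  rw [val_algebraMap_add_algebraMap_mul_uniformizer v w h2 hϖ hπ hram] at hy
  refine ⟨a, b, ?_, ?_, rfl⟩
  · exact (T5ContinuousValuationExtension.val_algebraMap_le_one_iff a).mp (le_trans (le_max_left _ _) hy)
  · have hb : Valued.v (algebraMap (v.adicCompletion K) (w.adicCompletion L) b * (π : w.adicCompletion L)) ≤ 1 :=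
      le_trans (le_max_right _ _) hy
    by_cases hb0 : b = 0
    · subst hb0
      simp
    have hb0' : Valued.v b ≠ 0 := (Valuation.ne_zero_iff _).mpr hb0
    rw [map_mul, val_algebraMap_eq_exp_two_mul_log v w h2 hϖ hπ hram hb0,
      T5AdicCompletionNormGroup.val_uniformizer w hπ, ← WithZero.exp_add, ← WithZero.exp_zero,
      WithZero.exp_le_exp] at hb
    rw [← WithZero.exp_log hb0', ← WithZero.exp_zero, WithZero.exp_le_exp]
    omega

/-- `σ π ≠ π` (else `π ∈ K_v`). -/
theorem algEquiv_uniformizer_ne (h2 : Module.finrank (v.adicCompletion K) (w.adicCompletion L) = 2)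
    {ϖ : v.adicCompletionIntegers K} (hϖ : Irreducible ϖ) {π : w.adicCompletionIntegers L} (hπ : Irreducible π)
    (hram : ¬ Irreducible (algebraMap (v.adicCompletionIntegers K) (w.adicCompletionIntegers L) ϖ))
    (σ : (w.adicCompletion L) ≃ₐ[v.adicCompletion K] (w.adicCompletion L)) (hσ : σ ≠ 1) :
    σ (π : w.adicCompletion L) ≠ π := by
  haveI : FiniteDimensional (v.adicCompletion K) (w.adicCompletion L) := Module.finite_of_finrank_pos (by omega)
  intro h
  exact uniformizer_notMem_range v w h2 hϖ hπ hram (T5QuadraticAutomorphism.mem_range_of_fixed h2 σ hσ h)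

/-- THE `σ`-DIFFERENCE ESTIMATE: `v(y) ≤ exp(−m)` ⇒ `v(σ y − y) ≤ exp(1 − m) · v(σ π − π)`
(`v_E(σ y − y) ≥ m + t` with `t = i − 1`: `σ` lies in the ramification group `G_t`). -/
theorem val_algEquiv_sub_le (h2 : Module.finrank (v.adicCompletion K) (w.adicCompletion L) = 2)
    {ϖ : v.adicCompletionIntegers K} (hϖ : Irreducible ϖ) {π : w.adicCompletionIntegers L} (hπ : Irreducible π)
    (hram : ¬ Irreducible (algebraMap (v.adicCompletionIntegers K) (w.adicCompletionIntegers L) ϖ))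
    (σ : (w.adicCompletion L) ≃ₐ[v.adicCompletion K] (w.adicCompletion L))
    (y : w.adicCompletion L) (m : ℤ) (hy : Valued.v y ≤ WithZero.exp (-m)) :
    Valued.v (σ y - y) ≤ WithZero.exp (1 - m) * Valued.v (σ (π : w.adicCompletion L) - π) := by
  obtain ⟨a, b, rfl⟩ := exists_eq_algebraMap_add_algebraMap_mul_uniformizer v w h2 hϖ hπ hram y
  rw [algEquiv_sub_self, map_mul]
  have h1 : Valued.v (algebraMap (v.adicCompletion K) (w.adicCompletion L) b * (π : w.adicCompletion L)) ≤
      WithZero.exp (-m) := by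
    rw [val_algebraMap_add_algebraMap_mul_uniformizer v w h2 hϖ hπ hram] at hy
    exact le_trans (le_max_right _ _) hy
  rw [map_mul, T5AdicCompletionNormGroup.val_uniformizer w hπ] at h1
  have h2' : Valued.v (algebraMap (v.adicCompletion K) (w.adicCompletion L) b) ≤ WithZero.exp (1 - m) := by
    calc Valued.v (algebraMap (v.adicCompletion K) (w.adicCompletion L) b)
        = Valued.v (algebraMap (v.adicCompletion K) (w.adicCompletion L) b) * WithZero.exp (-1) *
            WithZero.exp 1 := by
          rw [mul_assoc, ← WithZero.exp_add]
          simp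
      _ ≤ WithZero.exp (-m) * WithZero.exp 1 := by gcongr
      _ = WithZero.exp (1 - m) := by
          rw [← WithZero.exp_add]
          congr 1
          ring
  gcongr

/-- For integral `y`: `v(σ y − y) ≤ v(σ π − π)` (`v_E(σ y − y) ≥ i`). -/
theorem val_algEquiv_sub_le_of_val_le_one (h2 : Module.finrank (v.adicCompletion K) (w.adicCompletion L) = 2)
    {ϖ : v.adicCompletionIntegers K} (hϖ : Irreducible ϖ) {π : w.adicCompletionIntegers L} (hπ : Irreducible π)
    (hram : ¬ Irreducible (algebraMap (v.adicCompletionIntegers K) (w.adicCompletionIntegers L) ϖ))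
    (σ : (w.adicCompletion L) ≃ₐ[v.adicCompletion K] (w.adicCompletion L))
    {y : w.adicCompletion L} (hy : Valued.v y ≤ 1) :
    Valued.v (σ y - y) ≤ Valued.v (σ (π : w.adicCompletion L) - π) := by
  obtain ⟨a, b, -, hb, rfl⟩ :=
    exists_eq_algebraMap_add_algebraMap_mul_uniformizer_of_val_le_one v w h2 hϖ hπ hram hy
  rw [algEquiv_sub_self, map_mul]
  have : Valued.v (algebraMap (v.adicCompletion K) (w.adicCompletion L) b) ≤ 1 :=
    (T5ContinuousValuationExtension.val_algebraMap_le_one_iff b).mpr hb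
  calc Valued.v (algebraMap (v.adicCompletion K) (w.adicCompletion L) b) *
        Valued.v (σ (π : w.adicCompletion L) - π)
      ≤ 1 * Valued.v (σ (π : w.adicCompletion L) - π) := by gcongr
    _ = _ := one_mul _

section Break

variable [IsScalarTower K (v.adicCompletion K) (w.adicCompletion L)]

/-- THE BREAK EXPONENT: `v(σ π − π) = exp(−i)` with `i ≥ 1`. -/
theorem exists_val_algEquiv_sub_uniformizer_eq
    (h2 : Module.finrank (v.adicCompletion K) (w.adicCompletion L) = 2)
    {ϖ : v.adicCompletionIntegers K} (hϖ : Irreducible ϖ) {π : w.adicCompletionIntegers L} (hπ : Irreducible π)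
    (hram : ¬ Irreducible (algebraMap (v.adicCompletionIntegers K) (w.adicCompletionIntegers L) ϖ))
    (σ : (w.adicCompletion L) ≃ₐ[v.adicCompletion K] (w.adicCompletion L)) (hσ : σ ≠ 1) :
    ∃ i : ℕ, 1 ≤ i ∧ Valued.v (σ (π : w.adicCompletion L) - π) = WithZero.exp (-(i : ℤ)) := by
  have hne : σ (π : w.adicCompletion L) - π ≠ 0 :=
    sub_ne_zero.mpr (algEquiv_uniformizer_ne v w h2 hϖ hπ hram σ hσ)
  have h0 : Valued.v (σ (π : w.adicCompletion L) - π) ≠ 0 := (Valuation.ne_zero_iff _).mpr hne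
  have hle : Valued.v (σ (π : w.adicCompletion L) - π) ≤ WithZero.exp (-1) := by
    calc Valued.v (σ (π : w.adicCompletion L) - π)
        ≤ max (Valued.v (σ (π : w.adicCompletion L))) (Valued.v (π : w.adicCompletion L)) :=
          Valuation.map_sub _ _ _
      _ = WithZero.exp (-1) := by
          rw [T5AdicCompletionGaloisInvariance.val_algEquiv_apply, T5AdicCompletionNormGroup.val_uniformizer w hπ,
            max_self]
  set k := WithZero.log (Valued.v (σ (π : w.adicCompletion L) - π)) with hk
  have hvk : Valued.v (σ (π : w.adicCompletion L) - π) = WithZero.exp k := (WithZero.exp_log h0).symm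
  rw [hvk, WithZero.exp_le_exp] at hle
  refine ⟨(-k).toNat, by omega, ?_⟩
  rw [hvk]
  congr 1
  omega

end Break

end Ramified

end

end Summit.Ventures.HodgeRepro2.T5RamifiedIntegralBasis
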